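import Literature.RingTheory.MvPolynomial.LeadingExponents
import Literature.RingTheory.HilbertSamuel.PolynomialRing
import Mathlib.RingTheory.MvPolynomial.Homogeneous
import Mathlib.RingTheory.GradedAlgebra.Homogeneous.Ideal
import Mathlib.RingTheory.GradedAlgebra.Radical
import Mathlib.LinearAlgebra.FiniteDimensional.Lemmas
import Mathlib.RingTheory.MvPolynomial.Basic
import HarnessLib

/-!
# The Hilbert function of a homogeneous ideal of `K[X₀, …, X_n]`: lattice identities and the
# hypersurface-section (non-zero-divisor) formula

Topic: `Literature/RingTheory/MvPolynomial`. For a homogeneous ideal `I ⊆ S = K[X_σ]` (Mathlib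
`Ideal.IsHomogeneous (homogeneousSubmodule σ K) I`, with the local instance
`MvPolynomial.gradedAlgebra`) the **Hilbert function** is `H(I; t) = dim_K S_t - dim_K I_t`, where
`I_t = I ∩ S_t` is `idealDegree I t` (`LeadingExponents.lean`). This file is the linear-algebra layer
of the degree theory used for Bézout-type counting (van der Waerden 1928; Nesterenko–Philippon
(eds.), LNM 1752, Ch. 11 §2.2; Philippon, Bull. SMF 114 (1986) §3, Lemme 3.1), phrased on the
subspaces `I_t` so that no subtraction is needed:

* `idealDegree_inf`, `idealDegree_sup` (homogeneous `I`, `J`) and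
  **`finrank_idealDegree_inf_add_sup`**: `dim (I ∩ J)_t + dim (I + J)_t = dim I_t + dim J_t`;
* `idealDegree_sup_span_singleton`: for homogeneous `I` and a form `Q` of degree `q`,
  `(I + (Q))_{t+q} = I_{t+q} + Q·S_t`; hence **`finrank_idealDegree_sup_span_add_le`**:
  `dim (I + (Q))_{t+q} + dim I_t ≤ dim I_{t+q} + dim S_t` in general, with EQUALITY
  (**`finrank_idealDegree_sup_span_add_eq`**) when `Q` is a non-zero-divisor modulo `I`
  (Philippon 1986, Lemme 3.1: the exact sequence `0 → (S/I)_{t} →·Q (S/I)_{t+q} → (S/(I,Q))_{t+q} → 0`);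
  in Hilbert-function form: `H(I + (Q); t + q) = H(I; t + q) - H(I; t)`, resp. `≥`;
* `finiteDimensional_homogeneousSubmodule`, `finrank_idealDegree_le`, monotonicity in `I`,
  `idealDegree_bot`, `idealDegree_top`;
* **`exists_mem_forall_notMem_of_forall_not_le`** — avoidance of finitely many subspaces over an
  infinite field (a vector space is not a finite union of proper subspaces), the form of prime
  avoidance used to pick a form of degree `D` in an ideal outside finitely many primes
  (Nesterenko–Philippon LNM 1752, Ch. 11, proof of Prop. 2.2, citing Brownawell–Masser Lemma 5).

No new definitions: statements are about Mathlib's `homogeneousSubmodule`, `Ideal.IsHomogeneous`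
and `Literature.RingTheory.MvPolynomial.idealDegree`.

## References

* B. L. van der Waerden, *On Hilbert's function, series of composition of ideals and a
  generalization of the theorem of Bézout*, Proc. Royal Acad. Amsterdam 31 (1928), 749–770.
* Yu. V. Nesterenko, P. Philippon (eds.), *Introduction to Algebraic Independence Theory*,
  LNM 1752 (2001), Ch. 11 (D. Roy), §2.2. [NesterenkoPhilippon2001]
* P. Philippon, *Lemmes de zéros dans les groupes algébriques commutatifs*, Bull. Soc. Math.
  France 114 (1986), §3, Lemme 3.1. [Philippon1986]
-/

noncomputable section

open MvPolynomial Module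

attribute [local instance] MvPolynomial.gradedAlgebra

namespace Literature.RingTheory.MvPolynomial

variable {K : Type*} [Field K] {σ : Type*}

/-! ## The pieces `S_t` and `I_t` -/

/-- `S_t` is finite-dimensional when there are finitely many variables (it is spanned by the
finitely many monomials of degree `t`; Mathlib `homogeneousSubmodule_fg`). A theorem, not an
instance (used through `haveI`). [folklore] -/
theorem finite_homogeneousSubmodule [Finite σ] (t : ℕ) :
    Module.Finite K (homogeneousSubmodule σ K t) :=
  Module.Finite.iff_fg.mpr (homogeneousSubmodule_fg σ K t)

/-- `I_t ⊆ S_t`. [folklore] -/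
theorem idealDegree_le_homogeneousSubmodule (I : Ideal (MvPolynomial σ K)) (t : ℕ) :
    idealDegree I t ≤ homogeneousSubmodule σ K t := inf_le_right

/-- `dim I_t ≤ dim S_t`. [folklore] -/
theorem finrank_idealDegree_le [Finite σ] (I : Ideal (MvPolynomial σ K)) (t : ℕ) :
    finrank K (idealDegree I t) ≤ finrank K (homogeneousSubmodule σ K t) :=
  haveI := finite_homogeneousSubmodule (K := K) (σ := σ) t
  Submodule.finrank_mono (idealDegree_le_homogeneousSubmodule I t)

/-- `I ↦ I_t` is monotone. [folklore] -/
theorem idealDegree_mono {I J : Ideal (MvPolynomial σ K)} (h : I ≤ J) (t : ℕ) :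
    idealDegree I t ≤ idealDegree J t := fun _ hf => ⟨h hf.1, hf.2⟩

/-- `dim I_t ≤ dim J_t` for `I ≤ J`. [folklore] -/
theorem finrank_idealDegree_mono [Finite σ] {I J : Ideal (MvPolynomial σ K)} (h : I ≤ J) (t : ℕ) :
    finrank K (idealDegree I t) ≤ finrank K (idealDegree J t) :=
  Submodule.finrank_mono (idealDegree_mono h t)

/-- `(0)_t = 0`. [folklore] -/
@[simp] theorem idealDegree_bot (t : ℕ) : idealDegree (⊥ : Ideal (MvPolynomial σ K)) t = ⊥ := by
  ext f
  simp only [mem_idealDegree, Ideal.mem_bot, Submodule.mem_bot, and_iff_left_iff_imp]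
  rintro rfl
  exact isHomogeneous_zero σ K t

/-- `(1)_t = S_t`. [folklore] -/
@[simp] theorem idealDegree_top (t : ℕ) :
    idealDegree (⊤ : Ideal (MvPolynomial σ K)) t = homogeneousSubmodule σ K t := by
  ext f
  simp [mem_idealDegree, mem_homogeneousSubmodule]

/-! ## Lattice identities -/

/-- `(I ∩ J)_t = I_t ∩ J_t`. [folklore] -/
theorem idealDegree_inf (I J : Ideal (MvPolynomial σ K)) (t : ℕ) :
    idealDegree (I ⊓ J) t = idealDegree I t ⊓ idealDegree J t := by
  ext f
  simp only [mem_idealDegree, Ideal.mem_inf, Submodule.mem_inf]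
  tauto

/-- `(I + J)_t = I_t + J_t` for HOMOGENEOUS `I`, `J` (take degree-`t` components of a
decomposition `f = i + j`). [folklore] -/
theorem idealDegree_sup {I J : Ideal (MvPolynomial σ K)}
    (hI : I.IsHomogeneous (homogeneousSubmodule σ K))
    (hJ : J.IsHomogeneous (homogeneousSubmodule σ K)) (t : ℕ) :
    idealDegree (I ⊔ J) t = idealDegree I t ⊔ idealDegree J t := by
  apply le_antisymm
  · intro f hf
    obtain ⟨hfIJ, hft⟩ := hf
    obtain ⟨i, hi, j, hj, rfl⟩ := Submodule.mem_sup.mp hfIJ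
    rw [← homogeneousComponent_eq_self hft, map_add]
    exact Submodule.add_mem_sup
      ⟨homogeneousComponent_mem_of_mem hI hi t, homogeneousComponent_isHomogeneous t i⟩
      ⟨homogeneousComponent_mem_of_mem hJ hj t, homogeneousComponent_isHomogeneous t j⟩
  · exact sup_le (idealDegree_mono le_sup_left t) (idealDegree_mono le_sup_right t)

/-- **`dim (I ∩ J)_t + dim (I + J)_t = dim I_t + dim J_t`** for homogeneous `I`, `J` (the exact
sequence `0 → S/(I∩J) → S/I ⊕ S/J → S/(I+J) → 0` degree by degree; in Hilbert-function form
`H(I ∩ J; t) + H(I + J; t) = H(I; t) + H(J; t)`). [folklore] -/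
theorem finrank_idealDegree_inf_add_sup [Finite σ] {I J : Ideal (MvPolynomial σ K)}
    (hI : I.IsHomogeneous (homogeneousSubmodule σ K))
    (hJ : J.IsHomogeneous (homogeneousSubmodule σ K)) (t : ℕ) :
    finrank K (idealDegree (I ⊓ J) t) + finrank K (idealDegree (I ⊔ J) t) =
      finrank K (idealDegree I t) + finrank K (idealDegree J t) := by
  rw [idealDegree_inf, idealDegree_sup hI hJ, add_comm,
    Submodule.finrank_sup_add_finrank_inf_eq]

/-! ## Hypersurface sections: the ideal `I + (Q)` for a form `Q` of degree `q` -/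

/-- The degree-`(t+q)` component of `Q · r` is `Q · r_t` for a form `Q` of degree `q`.
[folklore] -/
theorem homogeneousComponent_mul_add_of_isHomogeneous {Q : MvPolynomial σ K} {q : ℕ}
    (hQ : Q.IsHomogeneous q) (r : MvPolynomial σ K) (t : ℕ) :
    homogeneousComponent (t + q) (Q * r) = Q * homogeneousComponent t r := by
  classical
  conv_lhs => rw [← sum_homogeneousComponent r, Finset.mul_sum, map_sum]
  have hterm : ∀ n, homogeneousComponent (t + q) (Q * homogeneousComponent n r) =
      if n = t then Q * homogeneousComponent n r else 0 := by
    intro n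
    have hmem : Q * homogeneousComponent n r ∈ homogeneousSubmodule σ K (q + n) :=
      hQ.mul (homogeneousComponent_isHomogeneous n r)
    rw [homogeneousComponent_of_mem hmem]
    by_cases hn : n = t
    · subst hn; simp [add_comm]
    · rw [if_neg (by omega), if_neg hn]
  simp only [hterm, Finset.sum_ite_eq', Finset.mem_range]
  split_ifs with h
  · rfl
  · rw [homogeneousComponent_eq_zero]
    · simp
    · omega

/-- **`(I + (Q))_{t+q} = I_{t+q} + Q · S_t`** for a homogeneous ideal `I` and a form `Q` of
degree `q`. [folklore] -/
theorem idealDegree_sup_span_singleton {I : Ideal (MvPolynomial σ K)}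
    (hI : I.IsHomogeneous (homogeneousSubmodule σ K)) {Q : MvPolynomial σ K} {q : ℕ}
    (hQ : Q.IsHomogeneous q) (t : ℕ) :
    idealDegree (I ⊔ Ideal.span {Q}) (t + q) =
      idealDegree I (t + q) ⊔ (homogeneousSubmodule σ K t).map (LinearMap.mulLeft K Q) := by
  apply le_antisymm
  · rintro f ⟨hf, hft⟩
    obtain ⟨i, hi, j, hj, rfl⟩ := Submodule.mem_sup.mp hf
    obtain ⟨r, rfl⟩ := Ideal.mem_span_singleton'.mp hj
    rw [← homogeneousComponent_eq_self hft, map_add, mul_comm r Q,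
      homogeneousComponent_mul_add_of_isHomogeneous hQ r t]
    refine Submodule.add_mem_sup
      ⟨homogeneousComponent_mem_of_mem hI hi _, homogeneousComponent_isHomogeneous _ i⟩ ?_
    exact ⟨homogeneousComponent t r, homogeneousComponent_mem t r, rfl⟩
  · refine sup_le (idealDegree_mono le_sup_left _) ?_
    rintro _ ⟨r, hr, rfl⟩
    refine ⟨Ideal.mem_sup_right (Ideal.mem_span_singleton'.mpr ⟨r, mul_comm r Q⟩), ?_⟩
    simpa [add_comm] using hQ.mul (show r.IsHomogeneous t from hr)

/-- `Q · I_t ⊆ I_{t+q} ∩ Q · S_t`. [folklore] -/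
theorem map_mulLeft_idealDegree_le {I : Ideal (MvPolynomial σ K)} {Q : MvPolynomial σ K} {q : ℕ}
    (hQ : Q.IsHomogeneous q) (t : ℕ) :
    (idealDegree I t).map (LinearMap.mulLeft K Q) ≤
      idealDegree I (t + q) ⊓ (homogeneousSubmodule σ K t).map (LinearMap.mulLeft K Q) := by
  rintro _ ⟨r, ⟨hrI, hrt⟩, rfl⟩
  refine ⟨⟨I.mul_mem_left Q hrI, ?_⟩, r, hrt, rfl⟩
  simpa [add_comm] using hQ.mul hrt

/-- With `Q` a non-zero-divisor modulo `I`: `I_{t+q} ∩ Q · S_t = Q · I_t`. [folklore] -/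
theorem idealDegree_inf_map_mulLeft_eq {I : Ideal (MvPolynomial σ K)} {Q : MvPolynomial σ K}
    {q : ℕ} (hQ : Q.IsHomogeneous q) (hnzd : ∀ f, Q * f ∈ I → f ∈ I) (t : ℕ) :
    idealDegree I (t + q) ⊓ (homogeneousSubmodule σ K t).map (LinearMap.mulLeft K Q) =
      (idealDegree I t).map (LinearMap.mulLeft K Q) := by
  refine le_antisymm ?_ (map_mulLeft_idealDegree_le hQ t)
  rintro _ ⟨⟨hfI, -⟩, r, hrt, rfl⟩
  exact ⟨r, ⟨hnzd r hfI, hrt⟩, rfl⟩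

/-- Multiplication by a non-zero polynomial does not change dimensions of subspaces.
[folklore] -/
theorem finrank_map_mulLeft {Q : MvPolynomial σ K} (hQ : Q ≠ 0)
    (V : Submodule K (MvPolynomial σ K)) [FiniteDimensional K V] :
    finrank K (V.map (LinearMap.mulLeft K Q)) = finrank K V :=
  LinearEquiv.finrank_eq
    (Submodule.equivMapOfInjective _ (mul_right_injective₀ hQ) V).symm

/-- **Hypersurface section, general inequality**: for a homogeneous ideal `I` and a non-zero form
`Q` of degree `q`, `dim (I + (Q))_{t+q} + dim I_t ≤ dim I_{t+q} + dim S_t`, i.e.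
`H(I + (Q); t + q) ≥ H(I; t + q) - H(I; t)` (the sequence `(S/I)_t →·Q (S/I)_{t+q} → (S/(I,Q))_{t+q} → 0`
is exact). [folklore] -/
theorem finrank_idealDegree_sup_span_add_le [Finite σ] {I : Ideal (MvPolynomial σ K)}
    (hI : I.IsHomogeneous (homogeneousSubmodule σ K)) {Q : MvPolynomial σ K} (hQ0 : Q ≠ 0)
    {q : ℕ} (hQ : Q.IsHomogeneous q) (t : ℕ) :
    finrank K (idealDegree (I ⊔ Ideal.span {Q}) (t + q)) + finrank K (idealDegree I t) ≤
      finrank K (idealDegree I (t + q)) + finrank K (homogeneousSubmodule σ K t) := by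
  haveI := finite_homogeneousSubmodule (K := K) (σ := σ) t
  have h1 := Submodule.finrank_sup_add_finrank_inf_eq (idealDegree I (t + q))
    ((homogeneousSubmodule σ K t).map (LinearMap.mulLeft K Q))
  rw [← idealDegree_sup_span_singleton hI hQ t, finrank_map_mulLeft hQ0] at h1
  have h2 : finrank K (idealDegree I t) ≤
      finrank K ↥(idealDegree I (t + q) ⊓ (homogeneousSubmodule σ K t).map (LinearMap.mulLeft K Q)) := by
    rw [← finrank_map_mulLeft hQ0 (idealDegree I t)]
    exact Submodule.finrank_mono (map_mulLeft_idealDegree_le hQ t)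
  omega

/-- **Hypersurface section by a non-zero-divisor** (Philippon 1986, Lemme 3.1; Nesterenko–Philippon
LNM 1752 Ch. 11 §2.2 (iii), the ingredient of "Bézout's Lemma"): for a homogeneous ideal `I` and a
form `Q` of degree `q` which is a non-zero-divisor modulo `I`,
`dim (I + (Q))_{t+q} + dim I_t = dim I_{t+q} + dim S_t`, i.e. `H(I + (Q); t + q) = H(I; t+q) - H(I; t)`.
[cite: Philippon1986, Lemme 3.1] -/
theorem finrank_idealDegree_sup_span_add_eq [Finite σ] {I : Ideal (MvPolynomial σ K)}
    (hI : I.IsHomogeneous (homogeneousSubmodule σ K)) {Q : MvPolynomial σ K} (hQ0 : Q ≠ 0)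
    {q : ℕ} (hQ : Q.IsHomogeneous q) (hnzd : ∀ f, Q * f ∈ I → f ∈ I) (t : ℕ) :
    finrank K (idealDegree (I ⊔ Ideal.span {Q}) (t + q)) + finrank K (idealDegree I t) =
      finrank K (idealDegree I (t + q)) + finrank K (homogeneousSubmodule σ K t) := by
  haveI := finite_homogeneousSubmodule (K := K) (σ := σ) t
  have h1 := Submodule.finrank_sup_add_finrank_inf_eq (idealDegree I (t + q))
    ((homogeneousSubmodule σ K t).map (LinearMap.mulLeft K Q))
  rw [← idealDegree_sup_span_singleton hI hQ t, finrank_map_mulLeft hQ0,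
    idealDegree_inf_map_mulLeft_eq hQ hnzd, finrank_map_mulLeft hQ0] at h1
  omega

/-! ## The Hilbert function `H(I; t) = dim S_t - dim I_t` -/

/-- `H((0); t) = dim S_t = binom(t + m - 1, t)` in `m` variables. [folklore] -/
theorem finrank_homogeneousSubmodule_sub_finrank_idealDegree_bot (m t : ℕ) :
    finrank K (homogeneousSubmodule (Fin m) K t) -
        finrank K (idealDegree (⊥ : Ideal (MvPolynomial (Fin m) K)) t) = (t + m - 1).choose t := by
  rw [idealDegree_bot, finrank_bot, Nat.sub_zero,
    Literature.RingTheory.HilbertSamuel.finrank_homogeneousSubmodule_fin]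

/-- `H((1); t) = 0`. [folklore] -/
theorem finrank_homogeneousSubmodule_sub_finrank_idealDegree_top [Finite σ] (t : ℕ) :
    finrank K (homogeneousSubmodule σ K t) -
        finrank K (idealDegree (⊤ : Ideal (MvPolynomial σ K)) t) = 0 := by
  rw [idealDegree_top, Nat.sub_self]

/-- `H` is antitone in the ideal: `I ≤ J` gives `H(J; t) ≤ H(I; t)`. [folklore] -/
theorem hilbert_antitone [Finite σ] {I J : Ideal (MvPolynomial σ K)} (h : I ≤ J) (t : ℕ) :
    finrank K (homogeneousSubmodule σ K t) - finrank K (idealDegree J t) ≤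
      finrank K (homogeneousSubmodule σ K t) - finrank K (idealDegree I t) :=
  Nat.sub_le_sub_left (finrank_idealDegree_mono h t) _

/-- Hilbert-function form of the hypersurface inequality: `H(I; t + q) ≤ H(I; t) + H(I + (Q); t + q)`.
[folklore] -/
theorem hilbert_add_le_hilbert_add_hilbert_sup_span [Finite σ] {I : Ideal (MvPolynomial σ K)}
    (hI : I.IsHomogeneous (homogeneousSubmodule σ K)) {Q : MvPolynomial σ K} (hQ0 : Q ≠ 0)
    {q : ℕ} (hQ : Q.IsHomogeneous q) (t : ℕ) :
    finrank K (homogeneousSubmodule σ K (t + q)) - finrank K (idealDegree I (t + q)) ≤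
      (finrank K (homogeneousSubmodule σ K t) - finrank K (idealDegree I t)) +
        (finrank K (homogeneousSubmodule σ K (t + q)) -
          finrank K (idealDegree (I ⊔ Ideal.span {Q}) (t + q))) := by
  have h := finrank_idealDegree_sup_span_add_le hI hQ0 hQ t
  have h1 := finrank_idealDegree_le I t
  have h2 := finrank_idealDegree_le I (t + q)
  have h3 := finrank_idealDegree_le (I ⊔ Ideal.span {Q}) (t + q)
  omega

/-- Hilbert-function form of the non-zero-divisor formula:
`H(I + (Q); t + q) + H(I; t) = H(I; t + q)`. [cite: Philippon1986, Lemme 3.1] -/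
theorem hilbert_sup_span_add_hilbert_eq [Finite σ] {I : Ideal (MvPolynomial σ K)}
    (hI : I.IsHomogeneous (homogeneousSubmodule σ K)) {Q : MvPolynomial σ K} (hQ0 : Q ≠ 0)
    {q : ℕ} (hQ : Q.IsHomogeneous q) (hnzd : ∀ f, Q * f ∈ I → f ∈ I) (t : ℕ) :
    (finrank K (homogeneousSubmodule σ K (t + q)) -
        finrank K (idealDegree (I ⊔ Ideal.span {Q}) (t + q))) +
      (finrank K (homogeneousSubmodule σ K t) - finrank K (idealDegree I t)) =
      finrank K (homogeneousSubmodule σ K (t + q)) - finrank K (idealDegree I (t + q)) := by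
  have h := finrank_idealDegree_sup_span_add_eq hI hQ0 hQ hnzd t
  have h1 := finrank_idealDegree_le I t
  have h2 := finrank_idealDegree_le I (t + q)
  have h3 := finrank_idealDegree_le (I ⊔ Ideal.span {Q}) (t + q)
  omega

/-- Hilbert-function form of the lattice identity:
`H(I ∩ J; t) + H(I + J; t) = H(I; t) + H(J; t)`. [folklore] -/
theorem hilbert_inf_add_hilbert_sup [Finite σ] {I J : Ideal (MvPolynomial σ K)}
    (hI : I.IsHomogeneous (homogeneousSubmodule σ K))
    (hJ : J.IsHomogeneous (homogeneousSubmodule σ K)) (t : ℕ) :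
    (finrank K (homogeneousSubmodule σ K t) - finrank K (idealDegree (I ⊓ J) t)) +
      (finrank K (homogeneousSubmodule σ K t) - finrank K (idealDegree (I ⊔ J) t)) =
      (finrank K (homogeneousSubmodule σ K t) - finrank K (idealDegree I t)) +
        (finrank K (homogeneousSubmodule σ K t) - finrank K (idealDegree J t)) := by
  have h := finrank_idealDegree_inf_add_sup hI hJ t
  have h1 := finrank_idealDegree_le I t
  have h2 := finrank_idealDegree_le J t
  have h3 := finrank_idealDegree_le (I ⊔ J) t
  have h4 := finrank_idealDegree_le (I ⊓ J) t
  omega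

/-! ## Avoiding finitely many subspaces over an infinite field -/

/-- **A vector space over an infinite field is not a finite union of proper subspaces**, in the
relative form used for prime avoidance in a graded piece (LNM 1752, Ch. 11, proof of Prop. 2.2,
after Brownawell–Masser, Lemma 5): if `V ⊄ W` for every `W` in a finite family, some `v ∈ V` lies
in no `W`. [folklore] -/
theorem exists_mem_forall_notMem_of_forall_not_le [Infinite K] {M : Type*} [AddCommGroup M]
    [Module K M] (V : Submodule K M) (S : Finset (Submodule K M)) (h : ∀ W ∈ S, ¬ V ≤ W) :
    ∃ v ∈ V, ∀ W ∈ S, v ∉ W := by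
  classical
  induction S using Finset.induction_on with
  | empty => exact ⟨0, V.zero_mem, by simp⟩
  | insert W₀ S hW₀ ih =>
    obtain ⟨v, hvV, hv⟩ := ih fun W hW => h W (Finset.mem_insert_of_mem hW)
    by_cases hvW₀ : v ∉ W₀
    · exact ⟨v, hvV, by simpa [hvW₀] using hv⟩
    push Not at hvW₀
    obtain ⟨w, hwV, hwW₀⟩ := Set.not_subset.mp (h W₀ (Finset.mem_insert_self _ _))
    -- for each `W ∈ S` at most one scalar `c` has `v + c • w ∈ W`
    have hbad : ∀ W ∈ S, ∀ c c' : K, v + c • w ∈ W → v + c' • w ∈ W → c = c' := by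
      intro W hW c c' hc hc'
      by_contra hne
      have hsub : (c - c') • w ∈ W := by
        have := W.sub_mem hc hc'
        rwa [add_sub_add_left_eq_sub, ← sub_smul] at this
      have hw : w ∈ W := by
        rwa [W.smul_mem_iff (sub_ne_zero.mpr hne)] at hsub
      have hv' : v ∈ W := by
        have := W.sub_mem hc (W.smul_mem c hw)
        rwa [add_sub_cancel_right] at this
      exact hv W hW hv'
    -- choose, for each `W ∈ S`, the bad scalar if any; avoid them and `0`
    choose! f hf using fun W (hW : W ∈ S) => show ∃ c : K, ∀ c' : K, v + c' • w ∈ W → c' = c from by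
      by_cases hex : ∃ c : K, v + c • w ∈ W
      · obtain ⟨c, hc⟩ := hex
        exact ⟨c, fun c' hc' => hbad W hW c' c hc' hc⟩
      · exact ⟨0, fun c' hc' => (hex ⟨c', hc'⟩).elim⟩
    obtain ⟨c, hc⟩ := Infinite.exists_notMem_finset (insert 0 (S.image f))
    simp only [Finset.mem_insert, Finset.mem_image, not_or, not_exists, not_and] at hc
    refine ⟨v + c • w, V.add_mem hvV (V.smul_mem c hwV), ?_⟩
    intro W hW
    rcases Finset.mem_insert.mp hW with rfl | hW
    · intro hmem
      have : c • w ∈ W := by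
        have := W.sub_mem hmem hvW₀
        rwa [add_sub_cancel_left] at this
      rw [W.smul_mem_iff hc.1] at this
      exact hwW₀ this
    · intro hmem
      exact hc.2 W hW (hf W hW c hmem).symm

end Literature.RingTheory.MvPolynomial

end
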